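import Literature.NumberTheory.LFunctions.DirichletPolynomialCauchyMeanValue
import Literature.Analysis.FunctionSpaces.PlancherelL1L2
import Mathlib.Analysis.Fourier.FourierTransformDeriv
import HarnessLib

/-!
# Weighted Dirichlet polynomials at one point: Conrey–Iwaniec (2002) Lemma 5.1 / Corollary 5.2,
# Plancherel form, and the density of separated points against the Poisson kernel

B. Conrey, H. Iwaniec, *Spacing of zeros of Hecke L-functions and the class number problem*,
Acta Arith. 103 (2002), §5 [held text `paper:arxiv-math_0111012`, p0013 L40–p0014 L1].

* `sum_inv_one_add_sq_le`: for `δ`-separated points `𝒯 ⊂ [X₁, X₂]` (`0 < δ ≤ 1`),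
  `Σ_{t∈𝒯} (1+(τ−t)²)^{−1} ≤ (2/δ)∫_{X₁−δ/2}^{X₂+δ/2}(1+(τ−u)²)^{−1}du` ((5.10)–(5.12); the windows
  are disjoint, tree `Gallagher.sum_integral_le_integral_of_separated`), with the window bounds
  `≤ π` and `≤ (B−A)/(1+d²)` at distance `d`;
* `integral_weighted_norm_sq_fourier`: for `ω ∈ C¹(ℝ)`, `ω, ω′ ∈ L¹ ∩ L²`,
  `∫ (1+4π²ξ²)|ω̂(ξ)|² dξ = ‖ω‖₂² + ‖ω′‖₂²` (tree Plancherel `integral_norm_sq_fourierIntegral_eq`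
  + Mathlib `Real.fourier_deriv`), hence `ω̂ ∈ L¹` and Fourier inversion `ω(y) = ∫ ω̂(ξ)e^{2πiξy}dξ`;
* `norm_sq_weightedSum_le` — **Lemma 5.1 / Corollary 5.2** with `c_f` replaced by the `H¹` norm:
  `|Σ_{n≤N} a_n ω(log n) n^{−it}|² ≤ (c/2π) ∫ |D(τ)|² (1+(τ−t)²)^{−1} dτ`, `c ≥ ‖ω‖₂² + ‖ω′‖₂²`
  (`ω(log n) = ∫ ω̂(ξ) n^{2πiξ} dξ`, Cauchy–Schwarz against `(1+4π²ξ²)^{±1}`, substitution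
  `τ = t − 2πξ`). The paper's `c_f = ∫_1^∞(|f|²/x + x|f′|²)dx` is `‖ω‖₂² + ‖ω′‖₂²` for
  `ω(y) = f(e^y)`.
Everything PROVED; no definition.

«The programme SEARCHES and TYPES; no claim about Landau–Siegel zeros until a kernel theorem says so.»

## References
* [ConreyIwaniec2002] B. Conrey, H. Iwaniec, Acta Arith. 103 (2002) 259–312, arXiv:math/0111012:
  §5, Lemma 5.1 (5.3)–(5.4), Corollary 5.2 (5.5), (5.10)–(5.16), Lemma 5.3 (5.17),
  Proposition 5.4 (5.18)–(5.19).
-/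

noncomputable section

open Complex MeasureTheory Filter Set Finset Real FourierTransform
open scoped Topology Real

namespace Literature.NumberTheory.LFunctions

namespace WeightedMeanValue

open Gallagher (phase norm_phase continuous_phase natCast_cpow_eq_phase)

/-! ## §2. `δ`-separated points against the Poisson kernel -/

/-- Continuity of the Poisson kernel of (5.5) in the second variable. [cite: ConreyIwaniec2002, Corollary 5.2 (5.5)] -/
theorem continuous_inv_one_add_sq_sub (τ : ℝ) : Continuous fun u : ℝ => (1 + (τ - u) ^ 2)⁻¹ :=
  Continuous.inv₀ (by fun_prop) fun u => by positivity

/-- Continuity of the Poisson kernel of (5.5) in the first variable. [cite: ConreyIwaniec2002, Corollary 5.2 (5.5)] -/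
theorem continuous_inv_one_add_sq_sub' (t : ℝ) : Continuous fun τ : ℝ => (1 + (τ - t) ^ 2)⁻¹ :=
  Continuous.inv₀ (by fun_prop) fun τ => by positivity

/-- Continuity of the Cauchy kernel of (5.13). [cite: ConreyIwaniec2002, §5 (5.13)] -/
theorem continuous_cauchyKernel (T : ℝ) : Continuous fun τ : ℝ => (1 + τ ^ 2 / T ^ 2)⁻¹ :=
  Continuous.inv₀ (by fun_prop) fun τ => by positivity

/-- For `|u − t| ≤ 1/2`: `1 + (τ − u)² ≤ 2(1 + (τ − t)²)` (comparing the Poisson kernel at a point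
and on its `δ`-window, (5.10)–(5.11)). [cite: ConreyIwaniec2002, §5 (5.10)–(5.11)] -/
theorem one_add_sq_le_two_mul {τ t u : ℝ} (h : |u - t| ≤ 1 / 2) :
    1 + (τ - u) ^ 2 ≤ 2 * (1 + (τ - t) ^ 2) := by
  have h1 : (u - t) ^ 2 ≤ 1 / 4 := by
    have := abs_le.mp h
    nlinarith
  nlinarith [sq_nonneg (τ - t - (u - t)), sq_nonneg (τ - t + (u - t))]

/-- The Poisson weight at a point is dominated by its average over a `δ`-window:
`(1 + (τ − t)²)^{−1} ≤ (2/δ) ∫_{t−δ/2}^{t+δ/2} (1 + (τ − u)²)^{−1} du` (`0 < δ ≤ 1`).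
[cite: ConreyIwaniec2002, §5 (5.10)–(5.11)] -/
theorem inv_one_add_sq_le_integral {δ : ℝ} (hδ : 0 < δ) (hδ1 : δ ≤ 1) (τ t : ℝ) :
    (1 + (τ - t) ^ 2)⁻¹ ≤ (2 / δ) * ∫ u in (t - δ / 2)..(t + δ / 2), (1 + (τ - u) ^ 2)⁻¹ := by
  have hle : ∀ u ∈ Set.Icc (t - δ / 2) (t + δ / 2),
      (1 / 2) * (1 + (τ - t) ^ 2)⁻¹ ≤ (1 + (τ - u) ^ 2)⁻¹ := by
    intro u hu
    have hut : |u - t| ≤ 1 / 2 := by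
      rw [abs_le]; constructor <;> linarith [hu.1, hu.2]
    have h2 := one_add_sq_le_two_mul (τ := τ) hut
    rw [← inv_inv (1 / 2 : ℝ), ← mul_inv, inv_le_inv₀ (by positivity) (by positivity)]
    simpa using h2
  have hint : ∫ u in (t - δ / 2)..(t + δ / 2), (1 / 2) * (1 + (τ - t) ^ 2)⁻¹ ≤
      ∫ u in (t - δ / 2)..(t + δ / 2), (1 + (τ - u) ^ 2)⁻¹ := by
    exact intervalIntegral.integral_mono_on (by linarith) intervalIntegrable_const
      ((continuous_inv_one_add_sq_sub τ).intervalIntegrable _ _) hle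
  rw [intervalIntegral.integral_const, smul_eq_mul] at hint
  have hδ' : t + δ / 2 - (t - δ / 2) = δ := by ring
  rw [hδ'] at hint
  rw [← div_le_iff₀' (by positivity : (0 : ℝ) < 2 / δ)]
  calc (1 + (τ - t) ^ 2)⁻¹ / (2 / δ) = δ * (1 / 2 * (1 + (τ - t) ^ 2)⁻¹) := by field_simp
    _ ≤ _ := hint

/-- **The density of `δ`-separated points against the Poisson kernel**: if the points of `𝒯`
lie in `[X₁, X₂]` and are pairwise `δ`-separated (`0 < δ ≤ 1`), then for every `τ`
`Σ_{t ∈ 𝒯} (1 + (τ − t)²)^{−1} ≤ (2/δ) ∫_{X₁−δ/2}^{X₂+δ/2} (1 + (τ − u)²)^{−1} du`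
(the windows are disjoint). [cite: ConreyIwaniec2002, §5 (5.10)–(5.12)] -/
theorem sum_inv_one_add_sq_le {δ : ℝ} (hδ : 0 < δ) (hδ1 : δ ≤ 1) (𝒯 : Finset ℝ) {X₁ X₂ : ℝ}
    (hX : X₁ ≤ X₂) (hmem : ∀ t ∈ 𝒯, X₁ ≤ t ∧ t ≤ X₂)
    (hsep : ∀ t ∈ 𝒯, ∀ t' ∈ 𝒯, t ≠ t' → δ ≤ |t - t'|) (τ : ℝ) :
    ∑ t ∈ 𝒯, (1 + (τ - t) ^ 2)⁻¹ ≤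
      (2 / δ) * ∫ u in (X₁ - δ / 2)..(X₂ + δ / 2), (1 + (τ - u) ^ 2)⁻¹ := by
  have h1 : ∑ t ∈ 𝒯, (1 + (τ - t) ^ 2)⁻¹ ≤
      ∑ t ∈ 𝒯, (2 / δ) * ∫ u in (t - δ / 2)..(t + δ / 2), (1 + (τ - u) ^ 2)⁻¹ :=
    Finset.sum_le_sum fun t _ => inv_one_add_sq_le_integral hδ hδ1 τ t
  refine h1.trans ?_
  rw [← Finset.mul_sum]
  refine mul_le_mul_of_nonneg_left ?_ (by positivity)
  exact Gallagher.sum_integral_le_integral_of_separated (continuous_inv_one_add_sq_sub τ) (fun u => by positivity) hδ 𝒯 hsep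
    (X₁ - δ / 2) (X₂ + δ / 2) (by linarith) (fun t ht => by constructor <;> linarith [hmem t ht])

/-- The window integral of the Poisson kernel is at most `π` ("`G(t) < π/δ`").
[cite: ConreyIwaniec2002, §5 (display after (5.11))] -/
theorem intervalIntegral_inv_one_add_sq_le_pi (τ A B : ℝ) (hAB : A ≤ B) :
    ∫ u in A..B, (1 + (τ - u) ^ 2)⁻¹ ≤ π := by
  have hint : Integrable fun u : ℝ => (1 + (τ - u) ^ 2)⁻¹ := by
    have h := integrable_inv_one_add_sq.comp_sub_left τ
    exact h
  rw [intervalIntegral.integral_of_le hAB]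
  calc ∫ u in Set.Ioc A B, (1 + (τ - u) ^ 2)⁻¹ ≤ ∫ u : ℝ, (1 + (τ - u) ^ 2)⁻¹ :=
        setIntegral_le_integral hint (Eventually.of_forall fun u => by positivity)
    _ = ∫ u : ℝ, (1 + u ^ 2)⁻¹ := integral_sub_left_eq_self (fun u : ℝ => (1 + u ^ 2)⁻¹) volume τ
    _ = π := integral_univ_inv_one_add_sq

/-- The window integral of the Poisson kernel far from the window: if `dist(τ, [A,B]) ≥ d ≥ 0` then
`∫_A^B (1 + (τ − u)²)^{−1} du ≤ (B − A)/(1 + d²)` ("if `t` is far beyond the segment (5.7) we can do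
better"). [cite: ConreyIwaniec2002, §5 (display before (5.12))] -/
theorem intervalIntegral_inv_one_add_sq_le_of_dist {τ A B d : ℝ} (hAB : A ≤ B) (hd : 0 ≤ d)
    (hfar : ∀ u ∈ Set.Icc A B, d ≤ |τ - u|) :
    ∫ u in A..B, (1 + (τ - u) ^ 2)⁻¹ ≤ (B - A) / (1 + d ^ 2) := by
  have hle : ∀ u ∈ Set.Icc A B, (1 + (τ - u) ^ 2)⁻¹ ≤ (1 + d ^ 2)⁻¹ := by
    intro u hu
    have h := hfar u hu
    have : d ^ 2 ≤ (τ - u) ^ 2 := by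
      rw [← sq_abs (τ - u)]; exact pow_le_pow_left₀ hd h 2
    exact inv_anti₀ (by positivity) (by linarith)
  have hint := intervalIntegral.integral_mono_on hAB
    ((continuous_inv_one_add_sq_sub τ).intervalIntegrable _ _)
    (intervalIntegrable_const (μ := volume)) hle
  rw [intervalIntegral.integral_const, smul_eq_mul] at hint
  rw [div_eq_mul_inv]
  exact hint

/-! ## §3. Lemma 5.1 / Corollary 5.2 (Plancherel form) -/

/-- `(1 + 4π²ξ²)^{−1}` is integrable (the weight `(t²+1)^{−1}` of (5.4) after `t = 2πξ`).
[cite: ConreyIwaniec2002, Lemma 5.1 (5.4)] -/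
theorem integrable_inv_one_add_four_pi_sq : Integrable fun ξ : ℝ => (1 + (2 * π * ξ) ^ 2)⁻¹ := by
  exact integrable_inv_one_add_sq.comp_mul_left' (R := 2 * π) (by positivity)

/-- **Plancherel with one derivative**: for `ω ∈ C¹`, `ω, ω′ ∈ L¹ ∩ L²`, the weighted `L²` norm of
the Fourier transform is `∫ (1 + 4π²ξ²) |ω̂(ξ)|² dξ = ‖ω‖₂² + ‖ω′‖₂²`, and in particular `ω̂` is
integrable (the Plancherel step "`∫|h|²dt = 2π∫x^{-1}|f|²`, `∫|h|²t²dt = 2π∫x|f′|²`" of Lemma 5.1).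
[cite: ConreyIwaniec2002, Lemma 5.1 (proof)] -/
theorem integral_weighted_norm_sq_fourier {ω : ℝ → ℂ} (hd : Differentiable ℝ ω)
    (hi : Integrable ω) (hi' : Integrable (deriv ω)) (h2 : MemLp ω 2) (h2' : MemLp (deriv ω) 2) :
    Integrable (fun ξ : ℝ => (1 + (2 * π * ξ) ^ 2) * ‖𝓕 ω ξ‖ ^ 2) ∧
    (∫ ξ : ℝ, (1 + (2 * π * ξ) ^ 2) * ‖𝓕 ω ξ‖ ^ 2) =
      (∫ y : ℝ, ‖ω y‖ ^ 2) + ∫ y : ℝ, ‖deriv ω y‖ ^ 2 := by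
  have hP1 := Literature.Analysis.FunctionSpaces.integral_norm_sq_fourierIntegral_eq hi h2
  have hP2 := Literature.Analysis.FunctionSpaces.integral_norm_sq_fourierIntegral_eq hi' h2'
  have hF2 : MemLp (𝓕 ω) 2 := Literature.Analysis.FunctionSpaces.memLp_two_fourierIntegral hi h2
  have hF2' : MemLp (𝓕 (deriv ω)) 2 :=
    Literature.Analysis.FunctionSpaces.memLp_two_fourierIntegral hi' h2'
  have hI1 : Integrable (fun ξ : ℝ => ‖𝓕 ω ξ‖ ^ 2) :=
    (memLp_two_iff_integrable_sq_norm hF2.1).1 hF2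
  have hI2 : Integrable (fun ξ : ℝ => ‖𝓕 (deriv ω) ξ‖ ^ 2) :=
    (memLp_two_iff_integrable_sq_norm hF2'.1).1 hF2'
  have hderiv : ∀ ξ : ℝ, ‖𝓕 (deriv ω) ξ‖ ^ 2 = (2 * π * ξ) ^ 2 * ‖𝓕 ω ξ‖ ^ 2 := by
    intro ξ
    rw [Real.fourier_deriv hi hd hi']
    dsimp only
    rw [smul_eq_mul, norm_mul, mul_pow]
    congr 1
    rw [show (2 * ↑π * Complex.I * ↑ξ : ℂ) = ((2 * π * ξ : ℝ) : ℂ) * Complex.I by push_cast; ring,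
      norm_mul, Complex.norm_I, mul_one, Complex.norm_real, Real.norm_eq_abs, sq_abs]
  have hI2' : Integrable (fun ξ : ℝ => (2 * π * ξ) ^ 2 * ‖𝓕 ω ξ‖ ^ 2) :=
    hI2.congr (Eventually.of_forall hderiv)
  have hsplit : (fun ξ : ℝ => (1 + (2 * π * ξ) ^ 2) * ‖𝓕 ω ξ‖ ^ 2) =
      fun ξ => ‖𝓕 ω ξ‖ ^ 2 + (2 * π * ξ) ^ 2 * ‖𝓕 ω ξ‖ ^ 2 := by
    funext ξ; ring
  refine ⟨by rw [hsplit]; exact hI1.add hI2', ?_⟩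
  rw [hsplit, integral_add hI1 hI2', hP1, ← hP2]
  congr 1
  exact integral_congr_ae (Eventually.of_forall fun ξ => (hderiv ξ).symm)

/-- The Fourier transform of a weight `ω ∈ C¹` with `ω, ω′ ∈ L¹ ∩ L²` is integrable
(`|ω̂| ≤ ((1+4π²ξ²)|ω̂|² + (1+4π²ξ²)^{−1})/2`), so Mellin/Fourier inversion applies in
Lemma 5.1. [cite: ConreyIwaniec2002, Lemma 5.1 (proof)] -/
theorem integrable_fourier_of_weight {ω : ℝ → ℂ} (hd : Differentiable ℝ ω)
    (hi : Integrable ω) (hi' : Integrable (deriv ω)) (h2 : MemLp ω 2) (h2' : MemLp (deriv ω) 2) :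
    Integrable (𝓕 ω) := by
  have hw := (integral_weighted_norm_sq_fourier hd hi hi' h2 h2').1
  have hcont : Continuous (𝓕 ω) := Literature.Analysis.FunctionSpaces.continuous_fourierIntegral hi
  refine Integrable.mono' ((hw.add integrable_inv_one_add_four_pi_sq).div_const 2)
    hcont.aestronglyMeasurable (Eventually.of_forall fun ξ => ?_)
  -- AM–GM: `a ≤ (w a² + 1/w)/2`
  set w : ℝ := 1 + (2 * π * ξ) ^ 2 with hw'
  have hw0 : 0 < w := by positivity
  set x : ℝ := ‖𝓕 ω ξ‖
  have hx : 0 ≤ x := norm_nonneg _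
  have key : x ≤ (w * x ^ 2 + w⁻¹) / 2 := by
    have : 0 ≤ (w * x - 1) ^ 2 / w := by positivity
    have e : (w * x - 1) ^ 2 / w = w * x ^ 2 - 2 * x + w⁻¹ := by field_simp; ring
    linarith
  simpa using key

/-- **Fourier inversion for the weight**: `ω(y) = ∫ ω̂(ξ) e^{2πiξy} dξ` ("`f(x) = (1/2π)∫h(t)x^{-it}dt`
by Mellin (or Fourier) inversion", proof of Lemma 5.1). [cite: ConreyIwaniec2002, Lemma 5.1 (proof)] -/
theorem weight_eq_integral_fourier {ω : ℝ → ℂ} (hd : Differentiable ℝ ω)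
    (hi : Integrable ω) (hi' : Integrable (deriv ω)) (h2 : MemLp ω 2) (h2' : MemLp (deriv ω) 2)
    (y : ℝ) :
    ω y = ∫ ξ : ℝ, Complex.exp (↑(2 * π * (ξ * y)) * Complex.I) * 𝓕 ω ξ := by
  have hinv := hi.fourierInv_fourier_eq (integrable_fourier_of_weight hd hi hi' h2 h2')
    (hd.continuous.continuousAt (x := y))
  rw [← hinv, Real.fourierInv_eq']
  congr 1; funext ξ; simp [mul_comm]

/-- **Lemma 5.1 / Corollary 5.2 (Conrey–Iwaniec), Plancherel form.** For a weight `ω ∈ C¹(ℝ)`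
with `ω, ω′ ∈ L¹ ∩ L²` and `‖ω‖₂² + ‖ω′‖₂² ≤ c`, any coefficients `a_n` and any real `t`,
`|Σ_{n ≤ N} a_n ω(log n) n^{−it}|² ≤ (c/2π) ∫_ℝ |Σ_{n ≤ N} a_n n^{−iτ}|² (1 + (τ − t)²)^{−1} dτ`.
(The paper's `c_f = ∫_1^∞ (|f(x)|²/x + x|f′(x)|²) dx` is `‖ω‖₂² + ‖ω′‖₂²` for `ω(y) = f(e^y)`.)
[cite: ConreyIwaniec2002, Lemma 5.1 (5.4), Corollary 5.2 (5.5)] -/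
theorem norm_sq_weightedSum_le {ω : ℝ → ℂ} (hd : Differentiable ℝ ω)
    (hi : Integrable ω) (hi' : Integrable (deriv ω)) (h2 : MemLp ω 2) (h2' : MemLp (deriv ω) 2)
    {c : ℝ} (hc : (∫ y : ℝ, ‖ω y‖ ^ 2) + (∫ y : ℝ, ‖deriv ω y‖ ^ 2) ≤ c)
    (a : ℕ → ℂ) (N : ℕ) (t : ℝ) :
    ‖∑ n ∈ Finset.Icc 1 N, a n * ω (Real.log n) * (n : ℂ) ^ (-((t : ℂ) * I))‖ ^ 2 ≤
      c / (2 * π) * ∫ τ : ℝ, ‖∑ n ∈ Finset.Icc 1 N, a n * (n : ℂ) ^ (-((τ : ℂ) * I))‖ ^ 2 *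
        (1 + (τ - t) ^ 2)⁻¹ := by
  set D : ℝ → ℂ := fun τ => ∑ n ∈ Finset.Icc 1 N, a n * (n : ℂ) ^ (-((τ : ℂ) * I)) with hD
  have hDc : Continuous D := continuous_dpoly a N
  set F : ℝ → ℂ := 𝓕 ω with hF
  obtain ⟨hwint, hweq⟩ := integral_weighted_norm_sq_fourier hd hi hi' h2 h2'
  have hFint : Integrable F := integrable_fourier_of_weight hd hi hi' h2 h2'
  set c₀ : ℝ := (∫ y : ℝ, ‖ω y‖ ^ 2) + ∫ y : ℝ, ‖deriv ω y‖ ^ 2 with hc₀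
  have hc₀0 : 0 ≤ c₀ := by positivity
  have hc0 : 0 ≤ c := hc₀0.trans hc
  set A : ℝ := ∑ n ∈ Finset.Icc 1 N, ‖a n‖ with hA
  have hA0 : 0 ≤ A := Finset.sum_nonneg fun _ _ => norm_nonneg _
  -- Step 1: the sum as an integral against `ω̂`
  set Φ : ℝ → ℂ := fun ξ => F ξ * D (t - 2 * π * ξ) with hΦ
  have hkey : ∑ n ∈ Finset.Icc 1 N, a n * ω (Real.log n) * (n : ℂ) ^ (-((t : ℂ) * I)) =
      ∫ ξ : ℝ, Φ ξ := by
    have hterm : ∀ n ∈ Finset.Icc 1 N, a n * ω (Real.log n) * (n : ℂ) ^ (-((t : ℂ) * I)) =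
        ∫ ξ : ℝ, F ξ * (a n * (n : ℂ) ^ (-(((t - 2 * π * ξ : ℝ) : ℂ) * I))) := by
      intro n hn
      rw [Finset.mem_Icc] at hn
      have hn0 : n ≠ 0 := by omega
      rw [weight_eq_integral_fourier hd hi hi' h2 h2' (Real.log n), ← integral_const_mul,
        ← integral_mul_const]
      refine integral_congr_ae (Eventually.of_forall fun ξ => ?_)
      simp only
      rw [natCast_cpow_eq_phase hn0, natCast_cpow_eq_phase hn0, Gallagher.phase, Gallagher.phase]
      have : Complex.exp (↑(2 * π * (ξ * Real.log n)) * Complex.I) *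
          Complex.exp (((-(t * Real.log n) : ℝ) : ℂ) * I) =
          Complex.exp (((-((t - 2 * π * ξ) * Real.log n) : ℝ) : ℂ) * I) := by
        rw [← Complex.exp_add]; congr 1; push_cast; ring
      calc a n * (Complex.exp (↑(2 * π * (ξ * Real.log ↑n)) * Complex.I) * F ξ) *
            Complex.exp (((-(t * Real.log n) : ℝ) : ℂ) * I)
          = F ξ * (a n * (Complex.exp (↑(2 * π * (ξ * Real.log n)) * Complex.I) *
              Complex.exp (((-(t * Real.log n) : ℝ) : ℂ) * I))) := by ring
        _ = F ξ * (a n * Complex.exp (((-((t - 2 * π * ξ) * Real.log n) : ℝ) : ℂ) * I)) := by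
            rw [this]
    rw [Finset.sum_congr rfl hterm, ← integral_finsetSum]
    · refine integral_congr_ae (Eventually.of_forall fun ξ => ?_)
      simp only [hΦ, hD, Finset.mul_sum]
    · intro n hn
      refine (hFint.norm.mul_const ‖a n‖).mono' ?_ (Eventually.of_forall fun ξ => ?_)
      · exact (hFint.aestronglyMeasurable.mul (Continuous.aestronglyMeasurable (by
          have hn0 : n ≠ 0 := by rw [Finset.mem_Icc] at hn; omega
          have : (fun ξ : ℝ => a n * (n : ℂ) ^ (-(((t - 2 * π * ξ : ℝ) : ℂ) * I))) =
              fun ξ => a n * Gallagher.phase n (t - 2 * π * ξ) := by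
            funext ξ; rw [natCast_cpow_eq_phase hn0]
          rw [this]
          exact continuous_const.mul ((Gallagher.continuous_phase n).comp (by fun_prop)))))
      · have hn0 : n ≠ 0 := by rw [Finset.mem_Icc] at hn; omega
        rw [norm_mul, norm_mul, natCast_cpow_eq_phase hn0, Gallagher.norm_phase, mul_one]
  -- Step 2: Cauchy–Schwarz with the weight `w(ξ) = 1 + 4π²ξ²`
  set wt : ℝ → ℝ := fun ξ => 1 + (2 * π * ξ) ^ 2 with hwt
  have hwt0 : ∀ ξ, 0 < wt ξ := fun ξ => by positivity
  set u : ℝ → ℝ := fun ξ => Real.sqrt (wt ξ) * ‖F ξ‖ with hu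
  set v : ℝ → ℝ := fun ξ => ‖D (t - 2 * π * ξ)‖ / Real.sqrt (wt ξ) with hv
  have hu2 : ∀ ξ, u ξ ^ 2 = wt ξ * ‖F ξ‖ ^ 2 := fun ξ => by
    simp only [hu]; rw [mul_pow, Real.sq_sqrt (hwt0 ξ).le]
  have hv2 : ∀ ξ, v ξ ^ 2 = ‖D (t - 2 * π * ξ)‖ ^ 2 * (wt ξ)⁻¹ := fun ξ => by
    simp only [hv]; rw [div_pow, Real.sq_sqrt (hwt0 ξ).le, div_eq_mul_inv]
  have huv : ∀ ξ, u ξ * v ξ = ‖F ξ‖ * ‖D (t - 2 * π * ξ)‖ := fun ξ => by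
    simp only [hu, hv]
    have := Real.sqrt_pos.mpr (hwt0 ξ)
    field_simp
  have hcontD : Continuous fun ξ : ℝ => D (t - 2 * π * ξ) :=
    hDc.comp (show Continuous fun ξ : ℝ => t - 2 * π * ξ by fun_prop)
  have hDbd : ∀ ξ, ‖D (t - 2 * π * ξ)‖ ≤ A := fun ξ => by rw [hD]; exact norm_dpoly_le a N _
  have hu2int : Integrable fun ξ => u ξ ^ 2 := by
    simp_rw [hu2]; exact hwint
  have hv2int : Integrable fun ξ => v ξ ^ 2 := by
    simp_rw [hv2]
    refine (integrable_inv_one_add_four_pi_sq.const_mul (A ^ 2)).mono' ?_ ?_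
    · exact ((hcontD.norm.pow 2).mul
        (Continuous.inv₀ (by fun_prop) fun ξ => (hwt0 ξ).ne')).aestronglyMeasurable
    · refine Eventually.of_forall fun ξ => ?_
      rw [Real.norm_of_nonneg (by positivity)]
      simp only [hwt]
      gcongr
      exact hDbd ξ
  have huvint : Integrable fun ξ => u ξ * v ξ := by
    simp_rw [huv]
    refine (hFint.norm.mul_const A).mono' (hFint.norm.aestronglyMeasurable.mul
      hcontD.norm.aestronglyMeasurable) (Eventually.of_forall fun ξ => ?_)
    rw [Real.norm_of_nonneg (by positivity)]
    exact mul_le_mul_of_nonneg_left (hDbd ξ) (norm_nonneg _)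
  have hCS := integral_mul_le_sqrt_mul_sqrt hu2int hv2int huvint
  have hnormΦ : ‖∫ ξ : ℝ, Φ ξ‖ ≤ ∫ ξ, u ξ * v ξ := by
    refine (norm_integral_le_integral_norm _).trans (le_of_eq ?_)
    refine integral_congr_ae (Eventually.of_forall fun ξ => ?_)
    simp only [hΦ, norm_mul, huv]
  -- Step 3: the substitution `τ = t − 2πξ`
  have hsub : ∫ ξ : ℝ, v ξ ^ 2 = (1 / (2 * π)) * ∫ τ : ℝ, ‖D τ‖ ^ 2 * (1 + (τ - t) ^ 2)⁻¹ := by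
    simp_rw [hv2, hwt]
    set g : ℝ → ℝ := fun x => ‖D (t - x)‖ ^ 2 * (1 + x ^ 2)⁻¹ with hg
    have h1 : (fun ξ : ℝ => ‖D (t - 2 * π * ξ)‖ ^ 2 * (1 + (2 * π * ξ) ^ 2)⁻¹) =
        fun ξ => g ((2 * π) * ξ) := by funext ξ; simp only [hg]
    rw [h1, Measure.integral_comp_mul_left g, abs_of_pos (by positivity), smul_eq_mul, inv_eq_one_div]
    congr 1
    have h2 : ∫ x : ℝ, g x = ∫ x : ℝ, (fun τ => ‖D τ‖ ^ 2 * (1 + (τ - t) ^ 2)⁻¹) (t - x) := by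
      refine integral_congr_ae (Eventually.of_forall fun x => ?_)
      simp only [hg]
      rw [show t - x - t = -x by ring, neg_sq]
    rw [h2, integral_sub_left_eq_self (fun τ => ‖D τ‖ ^ 2 * (1 + (τ - t) ^ 2)⁻¹) volume t]
  -- assemble
  have hI0 : 0 ≤ ∫ τ : ℝ, ‖D τ‖ ^ 2 * (1 + (τ - t) ^ 2)⁻¹ :=
    integral_nonneg fun τ => by positivity
  rw [hkey]
  calc ‖∫ ξ : ℝ, Φ ξ‖ ^ 2 ≤ (∫ ξ, u ξ * v ξ) ^ 2 :=
        pow_le_pow_left₀ (norm_nonneg _) hnormΦ 2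
    _ ≤ (Real.sqrt (∫ ξ, u ξ ^ 2) * Real.sqrt (∫ ξ, v ξ ^ 2)) ^ 2 :=
        pow_le_pow_left₀ (integral_nonneg fun ξ => by rw [huv]; positivity) hCS 2
    _ = (∫ ξ, u ξ ^ 2) * ∫ ξ, v ξ ^ 2 := by
        rw [mul_pow, Real.sq_sqrt (integral_nonneg fun _ => sq_nonneg _),
          Real.sq_sqrt (integral_nonneg fun _ => sq_nonneg _)]
    _ = c₀ * ((1 / (2 * π)) * ∫ τ : ℝ, ‖D τ‖ ^ 2 * (1 + (τ - t) ^ 2)⁻¹) := by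
        rw [hsub]; congr 1; simp_rw [hu2]; exact hweq
    _ ≤ c * ((1 / (2 * π)) * ∫ τ : ℝ, ‖D τ‖ ^ 2 * (1 + (τ - t) ^ 2)⁻¹) :=
        mul_le_mul_of_nonneg_right hc (by positivity)
    _ = c / (2 * π) * ∫ τ : ℝ, ‖D τ‖ ^ 2 * (1 + (τ - t) ^ 2)⁻¹ := by ring

end WeightedMeanValue

end Literature.NumberTheory.LFunctions

end
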